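import Summits.QuantumFields.YangMills.Theorems.BalabanUVNodesN12ChartRegularityTowerProxies
import Summits.QuantumFields.YangMills.Theorems.BalabanUVNodesN12WindowNearRegionGeometry
import Summits.QuantumFields.YangMills.Theorems.BalabanUVNodesN21ReadSetSupport
import Literature.MathematicalPhysics.QuantumFieldTheory.Balaban1983to89.Node00.LinearisedAveragingCovariantLocal
import Literature.MathematicalPhysics.QuantumFieldTheory.Balaban1983to89.T4ReflectionCone

/-!
# DAG node N12 [B15] — THE PER-BOND GUARDED PROXIES OF A (2.12)-CLASS CONFIGURATION (LOCATED-HSB repair pen ρ5b): every constrained bond `(j, c)` of `𝐁_k(Z)` admits a configuration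
# `U′`, equal to `U₀` on the tower `feeds j c` and GLOBALLY small-below, as soon as `U₀` lies in the (2.12) class of record — an axial gauge on the tower box, read through the class at
# level `j − 1`, flattened off the box and gauged back; hence the direct road's chart letters and multiplier for a (2.12) minimiser WITHOUT the global `SmallBelow` letter

[Balaban1985Variational] = «[15]», (2) p. 278, Sect. C (44)–(48) p. 285, (81)–(83) p. 290; [Balaban1988Convergent] = «[III]», (2.2) p. 255, (2.10)–(2.13) pp. 256–257;
[Balaban1985Averaging] = «[B-Av]», (19) p. 21 (axial gauge); [Balaban1989LargeFieldII] (1.12) p. 359.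

Cell `pub-ymgap`, HUMAN RULINGS D-0062 ∕ D-0149, lane owner `pub-ymgap-dag-n12-c` (g21).  Key K1⁹ `stmt-QuantumFields-27364`, `--kind proof --supports … --as helper`; count-neutral.
NEW leaf; CONSUMED BY NAME, nothing modified: this lane's `N12ChartRegularityTowerProxies` (ρ5a), dag-n12-w6's `N12WindowNearRegionGeometry.boxPlaqs_subset_plaqsOf_topSeq_pred` ∕
`exists_word_endpoints` (the tower box lies in the class region one level down), dag-n21's `N21ReadSetSupport.feeds_witness` ∕ `within_lift_of_blockIter_eq` (the tower's fine bonds sit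
within `3Lʲ − 3` of the source centre), the tree's torus axial gauge `T4AxialGaugeSmallField.dist1_gaugeAct_axialGauge_le_of_mem_boxBonds`, dag-n12-w4's
`Node00.exists_nearFlat_eqOn` (flatten off a bond set) and `Node00.smallBelow_gaugeAct` (gauge invariance of the guard).

WHY.  ρ5a delivers the chart letters at `U₀` from ONE guarded proxy per constrained bond.  Here the proxies are PRODUCED from the class `U_k({Ω_j(Z)}, εreg)` alone: for a level-`j`
constrained bond `c` (`1 ≤ j ≤ k`, one end in `Γ_j ⊆ Ω_j^{(j)}`) every fine bond of `feeds j c` lies in the coordinate box of half-width `3Lʲ − 3` (+2) about `ι_j c₋`; that box is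
within `Lʲ + 3Lʲ` of a point of `Ω_j`, hence (for `4L ≤ M₁`) its plaquettes have a corner in the class's level-`(j−1)` set, where `U₀` is `εreg·η_{j−1}²`-plaquette-small; the torus
axial gauge of the box then makes `U₀` bondwise `(d−1)(6Lʲ−4)·εreg·η_{j−1}² ≤ 6(d−1)L·εreg`-near-flat on the box; flattening off the box gives a globally near-flat field, small-below
by the height's radius letter `hsbU` (`Node00.exists_uniform_chartCurvature_sq_bound`), and gauging back with the inverse axial gauge restores `U₀` on the box while keeping the guard
(`smallBelow_gaugeAct`).  At level `0` (`Γ₀ = Ω₁ᶜ`, `feeds 0 c = {c}`) a PURE GAUGE of the identity field does it.  No holonomy obstruction: each tower is its own box.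

CONTENTS (namespace `Summit.QuantumFields.YangMills.BalabanUVNodes.N12TowerProxiesOfClass`; theorems only — no `def`, no `instance`, no `sorry`).
* §1 arithmetic ∕ torus bookkeeping (`three_le_L` is `T4ReflectionCone`'s): `towerBox_lt_sitesPerDir`, `boxSide_mul_eta_sq_le`, `gaugeAct_inv_gaugeAct_eq`, `Within.add_right`, `shift_ne_self`.
* §2 ★ `feeds_subset_boxBonds` — the tower of a level-`j` bond lies in the coordinate box of half-width `3Lʲ − 3` (+2) about `ι_j c₋`.
* §3 ★★★ `exists_boxProxy_of_plaqSmallOn` (class-free core: ANY non-wrapping coordinate box on which `U₀` is plaquette-small, budget `(d−1)·n·δ ≤ ρ″` ⇒ `U′ = U₀` on the whole box,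
  `SmallBelow k U′` — the shape dag-n12-w6 asked for, per-bond and per-site boxes being instances), ★★★ `exists_boxProxy_of_mem_class` (box with corners in the class's level-`j′` set),
  ★★★ `exists_towerProxy_of_mem_class_pos` (levels `1 ≤ j ≤ k`), ★★ `exists_towerProxy_zero` (level `0`), ★★★ `towerProxies_Bj_of_mem_class` (ρ5a's hypothesis `hprox` at
  `𝐁 = 𝐁_k(Z)`, VERBATIM, from class membership + `4L ≤ M₁`, `k + 1 ≤ m + K`, `LᵏM₁ ∣ 2L^{m+K}`, the radius letter `hsbU` and ONE numeric floor `6(d−1)L·εreg ≤ ρ″`).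
* §4 ★★★ `exists_lam_msChart_Bj_of_isMinimizer_regMSCoPOfRecord_of_class`, ★★ `chartLetters_msChart_Bj_of_isMinimizer_of_class` — the direct chart rows' `hlam` and regularity
  binders for a (2.12) minimiser with NO `SmallBelow` hypothesis.

HONEST FRAMING ∕ LOCATED.  Lattice bookkeeping and kernel calculus over landed modules; the radius `ρ″` is an ∃-constant per height `(F, K, k)` (`exists_uniform_chartCurvature_sq_bound`,
displayed as the letter `hsbU`), the floor `6(d−1)L·εreg ≤ ρ″` a volume-free smallness condition on the class threshold; the three `hsb` consumers (chart rows p660018, (P4)′ p664681,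
(P5) p656421) are NOT re-keyed here (ρ5c); nothing of Bałaban's asserted; count-neutral helper; N12 NOT discharged; K1⁹ NOT closed; counts unmoved; one finite 𝕋⁴ programme at
fixed ε — R4 closes the conditional finite-𝕋⁴ rung `BalabanLadder.UV` only; NOT continuum ∕ OS ∕ mass gap ∕ Clay.
-/

noncomputable section

open scoped BigOperators Matrix.Norms.L2Operator Topology
open Filter Finset

namespace Summit.QuantumFields.YangMills.BalabanUVNodes.N12TowerProxiesOfClass

open Literature.MathematicalPhysics.QuantumFieldTheory.Balaban1983to89
open T4Continuum (T4Family walkEnd)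
open T4AdjointCovarianceUnitary (lieSU)
open B15DeterminingSets
open B14.Eq213MaximalDomains (side)
open B14.Eq213DetSet (Bj Bj_of_gt Bj_mid Bj_top maxDomT)
open B14.Eq216Concrete (feeds inputs iter_local feeds_zero)
open B14DomainGeom (Within)
open B15Eq112TorusCover (lift cover cover_lift cover_eq_cover_iff cover_add_pmul)
open B15LatticeCubeTorus (pmul)
open T4AxialGaugeSmallField (castSite boxPlaqs boxBonds axialGauge dist1_gaugeAct_axialGauge_le_of_mem_boxBonds)
open B7Prop1Explicit (e e_apply)
open T4ReflectionCone (three_le_L)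
open Node00
open Summit.QuantumFields.YangMills.BalabanUVNodes.N12ChartRegularityTowerProxies (chartLetters_msChart_of_towerProxies fibreChart_and_lam_msChart_of_towerProxies)
open Summit.QuantumFields.YangMills.BalabanUVNodes.N12WindowNearRegionGeometry (boxPlaqs_subset_plaqsOf_topSeq_pred exists_word_endpoints)
open Summit.QuantumFields.YangMills.Theorems.N21ReadSetSupport (feeds_witness within_lift_of_blockIter_eq blockIter_embIter)

variable {F : T4Family} {N : ℕ} [NeZero N]

/-! ## §1  Arithmetic and torus bookkeeping -/

/-- The tower box side fits in the torus: `6Lⁿ − 4 < 2L^{m+K}` for `n ≤ k`, `k + 1 ≤ m + K`. [folklore] -/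
theorem towerBox_lt_sitesPerDir (P : Params) {k n : ℕ} (hkK : k + 1 ≤ P.m + P.K) (hn : n ≤ k) :
    6 * P.L ^ n - 4 < P.sitesPerDir 0 := by
  have hL := three_le_L P
  have h1 : P.L ^ n ≤ P.L ^ (P.m + P.K - 1) := Nat.pow_le_pow_right (by omega) (by omega)
  have h2 : P.sitesPerDir 0 = 2 * P.L ^ (P.m + P.K) := by simp [Params.sitesPerDir]
  have h3 : P.L ^ (P.m + P.K) = P.L * P.L ^ (P.m + P.K - 1) := by
    rw [← pow_succ']; congr 1; omega
  have h4 : 6 * P.L ^ n ≤ 6 * P.L ^ (P.m + P.K - 1) := Nat.mul_le_mul_left _ h1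
  have h5 : 6 * P.L ^ (P.m + P.K - 1) ≤ 2 * (P.L * P.L ^ (P.m + P.K - 1)) := by nlinarith
  have h6 : 6 * P.L ^ n ≤ P.sitesPerDir 0 := by rw [h2, h3]; exact h4.trans h5
  have h7 : 1 ≤ P.L ^ n := Nat.one_le_pow _ _ P.L_pos
  omega

/-- The axial-gauge budget of the tower box at the class tolerance one level down is height-free: `(6Lⁿ − 4)·η_{n−1}² ≤ 6L` (`n ≥ 1`, `η_j = L^{-j}`). [folklore] -/
theorem boxSide_mul_eta_sq_le (P : Params) {n : ℕ} (hn : 1 ≤ n) :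
    ((6 * P.L ^ n - 4 : ℕ) : ℝ) * P.eta (n - 1) ^ 2 ≤ 6 * (P.L : ℝ) := by
  obtain ⟨m, rfl⟩ : ∃ m, n = m + 1 := ⟨n - 1, by omega⟩
  rw [Nat.add_sub_cancel]
  have hL : (1 : ℝ) ≤ P.L := by exact_mod_cast P.L_pos
  have hLm : (1 : ℝ) ≤ (P.L : ℝ) ^ m := one_le_pow₀ hL
  have hpos : (0 : ℝ) < (P.L : ℝ) ^ m := by positivity
  have heta : P.eta m = ((P.L : ℝ) ^ m)⁻¹ := by simp [Params.eta, inv_pow]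
  have hcast : ((6 * P.L ^ (m + 1) - 4 : ℕ) : ℝ) ≤ 6 * ((P.L : ℝ) * (P.L : ℝ) ^ m) := by
    have h4 : 4 ≤ 6 * P.L ^ (m + 1) := by
      have := Nat.one_le_pow (m + 1) _ P.L_pos; omega
    rw [Nat.cast_sub h4]; push_cast; rw [pow_succ]; ring_nf; linarith
  rw [heta]
  calc ((6 * P.L ^ (m + 1) - 4 : ℕ) : ℝ) * (((P.L : ℝ) ^ m)⁻¹) ^ 2
      ≤ 6 * ((P.L : ℝ) * (P.L : ℝ) ^ m) * (((P.L : ℝ) ^ m)⁻¹) ^ 2 := by gcongr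
    _ = 6 * (P.L : ℝ) * (((P.L : ℝ) ^ m) * ((P.L : ℝ) ^ m)⁻¹) * ((P.L : ℝ) ^ m)⁻¹ := by ring
    _ = 6 * (P.L : ℝ) * ((P.L : ℝ) ^ m)⁻¹ := by rw [mul_inv_cancel₀ hpos.ne', mul_one]
    _ ≤ 6 * (P.L : ℝ) * 1 := by gcongr; exact inv_le_one_of_one_le₀ hLm
    _ = 6 * (P.L : ℝ) := by ring

/-- Gauging back with the pointwise inverse: `(u⁻¹ • V)(b) = U(b)` whenever `V(b) = (u • U)(b)`. [cite: Balaban1985Averaging, (8) p.19 (bookkeeping)] -/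
theorem gaugeAct_inv_gaugeAct_eq {P : Params} {G : Type*} [GaugeGroup G] (u : GaugeTransf P 0 G) (U V : GaugeField P 0 G) {b : PBond P 0}
    (hV : V b = GaugeField.gaugeAct u U b) : GaugeField.gaugeAct (fun s => (u s)⁻¹ : GaugeTransf P 0 G) V b = U b := by
  simp only [GaugeField.gaugeAct] at hV ⊢
  rw [hV]; group

/-- `Within` is translation invariant. [folklore] -/
theorem within_add_right {d : ℕ} {r : ℤ} {x y : B14DomainGeom.Pt d} (h : Within r x y) (t : B14DomainGeom.Pt d) : Within r (x + t) (y + t) := fun i => by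
  simp only [Pi.add_apply, add_sub_add_right_eq_sub]; exact h i

/-- A bond's two ends are distinct (the torus has at least two sites per direction). [folklore] -/
theorem shift_ne_self {P : Params} (x : Site P 0) (μ : Fin P.d) : x.shift μ ≠ x := by
  intro h
  have h1 := congrFun h μ
  rw [Site.shift_apply, if_pos rfl] at h1
  have h2 : (1 : ZMod (P.sitesPerDir 0)) = 0 := add_left_cancel (a := x μ) (by rw [add_zero]; exact h1)
  have h3 : 1 < P.sitesPerDir 0 := by
    have : P.sitesPerDir 0 = 2 * P.L ^ (P.m + P.K) := by simp [Params.sitesPerDir]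
    rw [this]; have := Nat.one_le_pow (P.m + P.K) _ P.L_pos; omega
  haveI : Fact (1 < P.sitesPerDir 0) := ⟨h3⟩
  exact one_ne_zero h2

/-! ## §2  The tower of a level-`j` bond lies in the coordinate box of half-width `3Lʲ − 3` (+2) about `ι_j c₋` -/

/-- ★ **THE TOWER IN A BOX**: for `j ≤ m + K`, every fine bond of `feeds j c` lies in `boxBonds (ι_j c₋ − (3Lʲ−3)) (ι_j c₋ + (3Lʲ−3) + 2)` (coordinates = the standard lift `·.val`): its source is
`cover x₀` with `x₀` within `2Lʲ − 2` of a cover point of the `j`-block of `c₋` (`feeds_witness`), itself within `Lʲ − 1` of `ι_j c₋` up to a deck translation, which `cover` forgets.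
[cite: Balaban1988Convergent, (2.11) p.256; Balaban1987RG1, (0.1) p.251] -/
theorem feeds_subset_boxBonds {P : Params} {j : ℕ} (hj : j ≤ P.m + P.K) (c : PBond P j) :
    feeds j c ⊆ (boxBonds (fun κ => (((embIter j c.src) κ).val : ℤ) - ((3 * P.L ^ j - 3 : ℕ) : ℤ))
      (fun κ => (((embIter j c.src) κ).val : ℤ) + ((3 * P.L ^ j - 3 : ℕ) : ℤ) + 2) : Set (PBond P 0)) := by
  intro b₀ hb₀
  obtain ⟨x, x₀, hx, hx₀, hw⟩ := feeds_witness hj c b₀ hb₀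
  -- bring `x` next to the standard lift of `ι_j c₋`
  have hblk : B14.Eq22Determines.blockIter j (cover P x) = B14.Eq22Determines.blockIter j (embIter j c.src) := by
    rw [hx, blockIter_embIter hj]
  have hW1 : Within (((P.L ^ j : ℕ) : ℤ) - 1) (lift P (cover P x)) (lift P (embIter j c.src)) := within_lift_of_blockIter_eq hj hblk
  obtain ⟨v, hv⟩ := (cover_eq_cover_iff (lift P (cover P x)) x).1 (by rw [cover_lift])
  -- the translated witness `x₀ − pmul v` projects to the same fine site and is within `3Lʲ − 3` of `ι_j c₋`
  set x₁ : B14DomainGeom.Pt P.d := x₀ + -pmul (B15Eq112TorusCover.per P) v with hx₁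
  have hcov : cover P x₁ = b₀.src := by
    have h : cover P (x₁ + pmul (B15Eq112TorusCover.per P) v) = cover P x₁ := cover_add_pmul x₁ v
    rw [hx₁, neg_add_cancel_right] at h
    rw [← hx₀, ← h]
  have hW2 : Within (2 * ((P.L ^ j : ℕ) : ℤ) - 2) (lift P (cover P x)) x₁ := by
    have h := within_add_right hw (-pmul (B15Eq112TorusCover.per P) v)
    rw [hv, add_neg_cancel_right] at h
    exact h
  have hW : Within (((3 * P.L ^ j - 3 : ℕ) : ℤ)) (lift P (embIter j c.src)) x₁ := by
    have h := Within.triangle hW1.symm hW2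
    have hq : 1 ≤ P.L ^ j := Nat.one_le_pow _ _ P.L_pos
    refine Within.mono ?_ h
    rw [Nat.cast_sub (by omega)]; push_cast; linarith
  refine ⟨x₁, fun κ => ?_, fun κ => ?_, hcov.symm⟩
  · have h := abs_le.1 (hW κ); simp only [lift] at h ⊢; linarith
  · have h := abs_le.1 (hW κ)
    simp only [Pi.add_apply, e_apply, lift] at h ⊢
    split_ifs <;> linarith

/-! ## §3  The per-bond proxies from the class -/

section Proxies

/-- ★★★ **THE BOX PROXY FROM PLAQUETTE SMALLNESS ON THE BOX** (class-free core; the shape dag-n12-w6 asked for, so that per-bond and per-site proxies are one-line instances): for a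
non-wrapping coordinate box `[lo, hi]` (`hi ≤ lo + n`, `n < 2L^{m+K}`) whose plaquettes lie in a set `S₀` on which `U₀` is `δ`-plaquette-small (`0 ≤ δ`), the radius letter `hsbU` of the
height and the budget `(d−1)·n·δ ≤ ρ″` give `U′ = U₀` on EVERY bond of the box with `SmallBelow k U′`: the torus axial gauge `u` of the box makes `u•U₀` bondwise `(d−1)nδ`-near-flat on the
box (`dist1_gaugeAct_axialGauge_le_of_mem_boxBonds`), flattening off the box gives a globally near-flat `V` (small-below by `hsbU`), and `u⁻¹•V` restores `U₀` on the box
(`smallBelow_gaugeAct`). [cite: Balaban1985Averaging, (19) p.21, (8) p.19; Balaban1985Variational, (2) p.278, (82)–(83) p.290; Balaban1988Convergent, (2.11) p.256] -/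
theorem exists_boxProxy_of_plaqSmallOn (Kt : ℕ) {k : ℕ} (hk : k ≤ (F.P Kt).m + (F.P Kt).K) {lo hi : Fin (F.P Kt).d → ℤ} {n : ℕ}
    (hnb : ∀ κ, hi κ ≤ lo κ + n) (hnN : n < (F.P Kt).sitesPerDir 0) {S₀ : Set (Plaq (F.P Kt) 0)} (hS₀ : (boxPlaqs lo hi : Set (Plaq (F.P Kt) 0)) ⊆ S₀)
    {δ : ℝ} (hδ0 : 0 ≤ δ) {U₀ : GaugeField (F.P Kt) 0 (SU N)} (hU : PlaqSmallOn S₀ δ U₀)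
    {ρ'' : ℝ} (hsbU : ∀ V : GaugeField (F.P Kt) 0 (SU N), ‖coeField V - 1‖ ≤ ρ'' → SmallBelow (avOfRecord F N Kt) k V)
    (hbudget : ((((F.P Kt).d - 1 : ℕ)) : ℝ) * n * δ ≤ ρ'') :
    ∃ U' : GaugeField (F.P Kt) 0 (SU N), (∀ b ∈ (boxBonds lo hi : Set (PBond (F.P Kt) 0)), U' b = U₀ b) ∧ SmallBelow (avOfRecord F N Kt) k U' := by
  set u : GaugeTransf (F.P Kt) 0 (SU N) := axialGauge U₀ lo hi with hu
  have hbond : ∀ b ∈ (boxBonds lo hi : Set (PBond (F.P Kt) 0)),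
      ‖((GaugeField.gaugeAct u U₀ b : SU N) : Matrix (Fin N) (Fin N) ℂ) - 1‖ ≤ ((((F.P Kt).d - 1 : ℕ)) : ℝ) * n * δ := by
    intro b hb
    have h := dist1_gaugeAct_axialGauge_le_of_mem_boxBonds U₀ hS₀ hU hδ0 hnb hnN hb
    have e1 : dist1 (GaugeField.gaugeAct u U₀ b) = ‖((GaugeField.gaugeAct u U₀ b : SU N) : Matrix (Fin N) (Fin N) ℂ) - 1‖ := rfl
    rw [← e1]; exact h
  obtain ⟨V, hVeq, hVflat⟩ := exists_nearFlat_eqOn (GaugeField.gaugeAct u U₀) (boxBonds lo hi : Set (PBond (F.P Kt) 0)) (by positivity) hbond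
  have hsbV : SmallBelow (avOfRecord F N Kt) k V := hsbU V (hVflat.trans hbudget)
  refine ⟨GaugeField.gaugeAct (fun s => (u s)⁻¹ : GaugeTransf (F.P Kt) 0 (SU N)) V, fun b hb => ?_,
    smallBelow_gaugeAct (P := F.P Kt) hk (fun s => (u s)⁻¹ : GaugeTransf (F.P Kt) 0 (SU N)) hsbV⟩
  exact gaugeAct_inv_gaugeAct_eq u U₀ V (hVeq b hb)

/-- ★★★ **THE BOX PROXY FROM THE CLASS** (dag-n12-w6's shape): a non-wrapping coordinate box whose plaquettes have a corner in the class's level-`j′` set (`j′ ≤ k`; e.g. by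
`boxPlaqs_subset_plaqsOf_topSeq_pred`), a configuration `U₀ ∈ U_k({Ω_j(Z)}, εreg)`, the radius letter and the budget `(d−1)·n·(εreg·η_{j′}²) ≤ ρ″` give `U′ = U₀` on the whole box with
`SmallBelow k U′`. [cite: Balaban1985Variational, (2) p.278, (82)–(83) p.290; Balaban1988Convergent, (2.11)–(2.13) pp.256–257; Balaban1985Averaging, (19) p.21] -/
theorem exists_boxProxy_of_mem_class (ν : Stage7Numerics) (Kt : ℕ) {k : ℕ} (hk : k ≤ (F.P Kt).m + (F.P Kt).K) (Z : Set (Site (F.P Kt) 0))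
    {lo hi : Fin (F.P Kt).d → ℤ} {n : ℕ} (hnb : ∀ κ, hi κ ≤ lo κ + n) (hnN : n < (F.P Kt).sitesPerDir 0) {j' : ℕ} (hj' : j' ≤ k)
    (hplaqs : (boxPlaqs lo hi : Set (Plaq (F.P Kt) 0)) ⊆ B8Eq17ClassAkV1.plaqsOf (topSeq (suppDomOfRecord F ν Kt (maxDomT ν.M₁ Z)) (maxDomT ν.M₁ Z) j'))
    (hε : 0 ≤ ν.εreg) {U₀ : GaugeField (F.P Kt) 0 (SU N)} (hU₀ : U₀ ∈ regMSCoPOfRecord F N ν Kt k (maxDomT ν.M₁ Z))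
    {ρ'' : ℝ} (hsbU : ∀ V : GaugeField (F.P Kt) 0 (SU N), ‖coeField V - 1‖ ≤ ρ'' → SmallBelow (avOfRecord F N Kt) k V)
    (hbudget : ((((F.P Kt).d - 1 : ℕ)) : ℝ) * n * (ν.εreg * (F.P Kt).eta j' ^ 2) ≤ ρ'') :
    ∃ U' : GaugeField (F.P Kt) 0 (SU N), (∀ b ∈ (boxBonds lo hi : Set (PBond (F.P Kt) 0)), U' b = U₀ b) ∧ SmallBelow (avOfRecord F N Kt) k U' :=
  exists_boxProxy_of_plaqSmallOn Kt hk hnb hnN hplaqs (by positivity) (hU₀.1 j' hj') hsbU hbudget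

/-- ★★★ **THE PROXY OF A POSITIVE-LEVEL CONSTRAINED BOND FROM THE CLASS**: for `1 ≤ j ≤ k` and `c` meeting `Γ_j(Z)` there is `U′ = U₀` on `feeds j c` with `SmallBelow k U′` — axial gauge on
the tower box (its plaquettes are `εreg·η_{j−1}²`-small: a corner in the class's level-`(j−1)` set, dag-n12-w6's `boxPlaqs_subset_plaqsOf_topSeq_pred` with the word from the `Γ_j`-end to
`c₋`), flatten off the box, small-below by the radius letter, gauge back.
[cite: Balaban1985Variational, (2) p.278, (82)–(83) p.290; Balaban1988Convergent, (2.2) p.255, (2.11)–(2.13) pp.256–257; Balaban1985Averaging, (19) p.21] -/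
theorem exists_towerProxy_of_mem_class_pos (ν : Stage7Numerics) (Kt : ℕ) {k : ℕ} (Z : Set (Site (F.P Kt) 0))
    (hkK : k + 1 ≤ (F.P Kt).m + (F.P Kt).K) (hM4 : 4 * (F.P Kt).L ≤ ν.M₁) (hdiv : side (F.P Kt).L ν.M₁ k ∣ (F.P Kt).sitesPerDir 0)
    (hε : 0 ≤ ν.εreg) {ρ'' : ℝ} (hsbU : ∀ V : GaugeField (F.P Kt) 0 (SU N), ‖coeField V - 1‖ ≤ ρ'' → SmallBelow (avOfRecord F N Kt) k V)
    (hερ : 6 * ((((F.P Kt).d - 1 : ℕ)) : ℝ) * (F.P Kt).L * ν.εreg ≤ ρ'')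
    {U₀ : GaugeField (F.P Kt) 0 (SU N)} (hU₀ : U₀ ∈ regMSCoPOfRecord F N ν Kt k (maxDomT ν.M₁ Z))
    {j : ℕ} (hj1 : 1 ≤ j) (hjk : j ≤ k) {c : PBond (F.P Kt) j} (hc : c ∈ bondsOf (Bj ν.M₁ Z k j)) :
    ∃ U' : GaugeField (F.P Kt) 0 (SU N), (∀ b ∈ feeds j c, U' b = U₀ b) ∧ SmallBelow (avOfRecord F N Kt) k U' := by
  have hk : k ≤ (F.P Kt).m + (F.P Kt).K := by omega
  have hjK : j ≤ (F.P Kt).m + (F.P Kt).K := hjk.trans hk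
  have hM1 : 1 ≤ ν.M₁ := le_trans (by have := three_le_L (F.P Kt); omega) hM4
  -- the end of `c` in `Γ_j ⊆ Ω_j^{(j)}`
  obtain ⟨y, hy, hyΩ⟩ : ∃ y : Site (F.P Kt) j, (y = c.src ∨ y = c.tgt) ∧ embIter j y ∈ maxDomT ν.M₁ Z j := by
    have hsub : Bj ν.M₁ Z k j ⊆ pts j (maxDomT ν.M₁ Z j) := by
      rcases lt_or_eq_of_le hjk with hlt | rfl
      · rw [Bj_mid hj1 hlt]; exact fun _ h => h.1
      · rw [Bj_top]
    rcases hc with h | h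
    · exact ⟨c.src, Or.inl rfl, mem_pts.1 (hsub h)⟩
    · exact ⟨c.tgt, Or.inr rfl, mem_pts.1 (hsub h)⟩
  obtain ⟨w₀, hw₀len, hw₀⟩ := exists_word_endpoints c hy (Or.inl rfl : c.src = c.src ∨ c.src = c.tgt)
  -- the box and its plaquettes in the class region one level down
  set R : ℕ := 3 * (F.P Kt).L ^ j - 3 with hR
  set lo : Fin (F.P Kt).d → ℤ := fun κ => (((embIter j c.src) κ).val : ℤ) - (R : ℤ) with hlo
  set hi : Fin (F.P Kt).d → ℤ := fun κ => (((embIter j c.src) κ).val : ℤ) + (R : ℤ) + 2 with hhi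
  have hq : 1 ≤ (F.P Kt).L ^ j := Nat.one_le_pow _ _ (F.P Kt).L_pos
  have hfitR : (F.P Kt).L ^ j + R + 3 ≤ (F.P Kt).L ^ (j - 1) * ν.M₁ := by
    obtain ⟨i, rfl⟩ : ∃ i, j = i + 1 := ⟨j - 1, by omega⟩
    rw [Nat.add_sub_cancel, hR]
    have h4A : 4 * (F.P Kt).L ^ (i + 1) ≤ (F.P Kt).L ^ i * ν.M₁ :=
      calc 4 * (F.P Kt).L ^ (i + 1) = (F.P Kt).L ^ i * (4 * (F.P Kt).L) := by ring
        _ ≤ (F.P Kt).L ^ i * ν.M₁ := Nat.mul_le_mul_left _ hM4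
    omega
  have hplaqs : (boxPlaqs lo hi : Set (Plaq (F.P Kt) 0)) ⊆
      B8Eq17ClassAkV1.plaqsOf (topSeq (suppDomOfRecord F ν Kt (maxDomT ν.M₁ Z)) (maxDomT ν.M₁ Z) (j - 1)) :=
    boxPlaqs_subset_plaqsOf_topSeq_pred ν Kt hj1 hjk hM1 hdiv Z hyΩ hw₀ hw₀len hfitR
  -- budget: `(d−1)(6Lʲ−4)·εreg·η_{j−1}² ≤ 6(d−1)L·εreg ≤ ρ″`
  have hnb : ∀ κ, hi κ ≤ lo κ + ((6 * (F.P Kt).L ^ j - 4 : ℕ) : ℕ) := fun κ => by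
    simp only [hlo, hhi, hR]
    omega
  have hnN : 6 * (F.P Kt).L ^ j - 4 < (F.P Kt).sitesPerDir 0 := towerBox_lt_sitesPerDir (F.P Kt) hkK hjk
  have hbudget : ((((F.P Kt).d - 1 : ℕ)) : ℝ) * ((6 * (F.P Kt).L ^ j - 4 : ℕ) : ℕ) * (ν.εreg * (F.P Kt).eta (j - 1) ^ 2) ≤ ρ'' := by
    refine le_trans ?_ hερ
    have hside := boxSide_mul_eta_sq_le (F.P Kt) hj1
    calc ((((F.P Kt).d - 1 : ℕ)) : ℝ) * ((6 * (F.P Kt).L ^ j - 4 : ℕ) : ℕ) * (ν.εreg * (F.P Kt).eta (j - 1) ^ 2)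
        = ((((F.P Kt).d - 1 : ℕ)) : ℝ) * ((((6 * (F.P Kt).L ^ j - 4 : ℕ) : ℝ) * (F.P Kt).eta (j - 1) ^ 2) * ν.εreg) := by ring
      _ ≤ ((((F.P Kt).d - 1 : ℕ)) : ℝ) * ((6 * ((F.P Kt).L : ℝ)) * ν.εreg) := by gcongr
      _ = 6 * ((((F.P Kt).d - 1 : ℕ)) : ℝ) * (F.P Kt).L * ν.εreg := by ring
  obtain ⟨U', hU', hsb'⟩ := exists_boxProxy_of_mem_class ν Kt hk Z hnb hnN (by omega : j - 1 ≤ k) hplaqs hε hU₀ hsbU hbudget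
  exact ⟨U', fun b hb => hU' b (feeds_subset_boxBonds hjK c hb), hsb'⟩

/-- ★★ **THE PROXY OF A LEVEL-0 CONSTRAINED BOND** (`Γ₀ = Ω₁ᶜ`, `feeds 0 c = {c}`): a PURE GAUGE of the identity field, `u(c₊) := U₀(c)⁻¹`, `u := 1` elsewhere — it reads `U₀(c)` at `c` and
is small-below by gauge invariance of the guard (the identity field is `ρ″`-near-flat). [cite: Balaban1988Convergent, (2.2) p.255, (2.11) p.256; Balaban1985Averaging, (8) p.19] -/
theorem exists_towerProxy_zero (Kt : ℕ) {k : ℕ} (hk : k ≤ (F.P Kt).m + (F.P Kt).K) {ρ'' : ℝ} (hρ0 : 0 ≤ ρ'')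
    (hsbU : ∀ V : GaugeField (F.P Kt) 0 (SU N), ‖coeField V - 1‖ ≤ ρ'' → SmallBelow (avOfRecord F N Kt) k V)
    (U₀ : GaugeField (F.P Kt) 0 (SU N)) (c : PBond (F.P Kt) 0) :
    ∃ U' : GaugeField (F.P Kt) 0 (SU N), (∀ b ∈ feeds 0 c, U' b = U₀ b) ∧ SmallBelow (avOfRecord F N Kt) k U' := by
  classical
  set u : GaugeTransf (F.P Kt) 0 (SU N) := fun s => if s = c.tgt then (U₀ c)⁻¹ else 1 with hu
  have hsb1 : SmallBelow (avOfRecord F N Kt) k (1 : GaugeField (F.P Kt) 0 (SU N)) := hsbU 1 (by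
    have : coeField (1 : GaugeField (F.P Kt) 0 (SU N)) - 1 = 0 := by
      funext b; simp [coeField]
    rw [this, norm_zero]; exact hρ0)
  refine ⟨GaugeField.gaugeAct u 1, fun b hb => ?_, smallBelow_gaugeAct (P := F.P Kt) hk u hsb1⟩
  rw [feeds_zero, Set.mem_singleton_iff] at hb
  subst hb
  have hne : b.src ≠ b.tgt := fun h => shift_ne_self b.src b.dir (h.symm)
  have h1 : u b.src = 1 := by simp only [hu, if_neg hne]
  have h2 : u b.tgt = (U₀ b)⁻¹ := by simp only [hu, if_pos rfl]
  show u b.src * (1 : GaugeField (F.P Kt) 0 (SU N)) b * (u b.tgt)⁻¹ = U₀ b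
  have h3 : (1 : GaugeField (F.P Kt) 0 (SU N)) b = 1 := rfl
  rw [h1, h2, h3, inv_inv, one_mul, one_mul]

/-- ★★★ **THE PER-BOND PROXIES OF `𝐁_k(Z)` FROM THE CLASS** — ρ5a's hypothesis `hprox` at `𝐁 = 𝐁_k(Z)` VERBATIM: every constrained bond `(j_i, c_i)` admits `U′ = U₀` on `feeds j_i c_i`
with `SmallBelow k U′`, for `U₀` in the (2.12) class of record (`4L ≤ M₁`, `k + 1 ≤ m + K`, `LᵏM₁ ∣ 2L^{m+K}`, `0 ≤ εreg`, the radius letter `hsbU` and the floor `6(d−1)L·εreg ≤ ρ″`).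
[cite: Balaban1985Variational, (2) p.278, (82)–(83) p.290; Balaban1988Convergent, (2.2) p.255, (2.11)–(2.13) pp.256–257] -/
theorem towerProxies_Bj_of_mem_class (ν : Stage7Numerics) (Kt : ℕ) {k : ℕ} (Z : Set (Site (F.P Kt) 0))
    (hkK : k + 1 ≤ (F.P Kt).m + (F.P Kt).K) (hM4 : 4 * (F.P Kt).L ≤ ν.M₁) (hdiv : side (F.P Kt).L ν.M₁ k ∣ (F.P Kt).sitesPerDir 0)
    (hε : 0 ≤ ν.εreg) {ρ'' : ℝ} (hsbU : ∀ V : GaugeField (F.P Kt) 0 (SU N), ‖coeField V - 1‖ ≤ ρ'' → SmallBelow (avOfRecord F N Kt) k V)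
    (hερ : 6 * ((((F.P Kt).d - 1 : ℕ)) : ℝ) * (F.P Kt).L * ν.εreg ≤ ρ'')
    {U₀ : GaugeField (F.P Kt) 0 (SU N)} (hU₀ : U₀ ∈ regMSCoPOfRecord F N ν Kt k (maxDomT ν.M₁ Z)) :
    ∀ i : Fin (constrCard (Bj ν.M₁ Z k) k), ∃ U' : GaugeField (F.P Kt) 0 (SU N),
      (∀ b ∈ feeds (((constrEnum (Bj ν.M₁ Z k) k).symm i).1 : ℕ) ((constrEnum (Bj ν.M₁ Z k) k).symm i).2.1, U' b = U₀ b) ∧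
        SmallBelow (avOfRecord F N Kt) k U' := by
  intro i
  have key : ∀ j, j ≤ k → ∀ c : PBond (F.P Kt) j, c ∈ bondsOf (Bj ν.M₁ Z k j) →
      ∃ U' : GaugeField (F.P Kt) 0 (SU N), (∀ b ∈ feeds j c, U' b = U₀ b) ∧ SmallBelow (avOfRecord F N Kt) k U' := by
    intro j hj c hc
    rcases Nat.eq_zero_or_pos j with rfl | hj1
    · exact exists_towerProxy_zero Kt (by omega) (le_trans (by have := three_le_L (F.P Kt); positivity) hερ) hsbU U₀ c
    · exact exists_towerProxy_of_mem_class_pos ν Kt Z hkK hM4 hdiv hε hsbU hερ hU₀ hj1 hj hc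
  exact key _ (Nat.le_of_lt_succ ((constrEnum (Bj ν.M₁ Z k) k).symm i).1.2) _ ((constrEnum (Bj ν.M₁ Z k) k).symm i).2.2

end Proxies

/-! ## §4  The direct chart rows' letters for a (2.12) minimiser WITHOUT the global small-below guard -/

/-- ★★★ **THE MULTIPLIER `hlam` AT `𝐁_k(Z)` FOR A (2.12) MINIMISER WITH NO `SmallBelow` HYPOTHESIS** — `Node00.exists_lam_msChart_Bj_of_isMinimizer_regMSCoPOfRecord` with `hsb` DISCHARGED:
per-bond proxies from the minimiser's own class (§3) fed to ρ5a.  Residual displayed rows: `4L ≤ M₁`, `k + 1 ≤ m + K`, the cube divisibility, `0 ≤ εreg`, the per-height radius letter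
`hsbU` (∃ by `Node00.exists_uniform_chartCurvature_sq_bound`, before `ν`) and the volume-free floor `6(d−1)L·εreg ≤ ρ″`.
[cite: Balaban1985Variational, (82)–(83) p.290; Balaban1989LargeFieldII, (1.12) p.359; Balaban1988Convergent, (2.12)–(2.13) pp.256–257] -/
theorem exists_lam_msChart_Bj_of_isMinimizer_regMSCoPOfRecord_of_class (ν : Stage7Numerics) (Kt : ℕ) {k : ℕ} (Z : Set (Site (F.P Kt) 0))
    (hkK : k + 1 ≤ (F.P Kt).m + (F.P Kt).K) (hM4 : 4 * (F.P Kt).L ≤ ν.M₁) (hdiv : side (F.P Kt).L ν.M₁ k ∣ (F.P Kt).sitesPerDir 0)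
    (hε : 0 ≤ ν.εreg) {ρ'' : ℝ} (hsbU : ∀ V : GaugeField (F.P Kt) 0 (SU N), ‖coeField V - 1‖ ≤ ρ'' → SmallBelow (avOfRecord F N Kt) k V)
    (hερ : 6 * ((((F.P Kt).d - 1 : ℕ)) : ℝ) * (F.P Kt).L * ν.εreg ≤ ρ'')
    {W : MSField (F.P Kt) (SU N)} {U₀ : GaugeField (F.P Kt) 0 (SU N)}
    (h : IsMinimizer (avOfRecord F N Kt) (regMSCoPOfRecord F N ν Kt k (maxDomT ν.M₁ Z)) (Bj ν.M₁ Z k) W U₀)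
    (hsurj : Function.Surjective (fderiv ℝ (msChart F N Kt k (Bj ν.M₁ Z k) W U₀) 0)) :
    ∃ lam : (Fin (constrCard (Bj ν.M₁ Z k) k) → lieSU (Fin N)) →L[ℝ] ℝ,
      fderiv ℝ (fun Y : PBond (F.P Kt) 0 → lieSU (Fin N) => wilsonAction4 (expChart U₀ Y)) 0 = lam.comp (fderiv ℝ (msChart F N Kt k (Bj ν.M₁ Z k) W U₀) 0) :=
  (fibreChart_and_lam_msChart_of_towerProxies (by omega) h.2.1 (towerProxies_Bj_of_mem_class ν Kt Z hkK hM4 hdiv hε hsbU hερ h.1)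
    (fun _ hj => Bj_of_gt hj) hsurj).2 (isCritOnFibre_of_isMinimizer_regMSCoPOfRecord ν (maxDomT ν.M₁ Z) h)

/-- ★★ **THE J-C REGULARITY LETTERS AT A (2.12) MINIMISER WITH NO `SmallBelow` HYPOTHESIS**: `C^∞` at `0`, the strict derivative, the pair `hΨ₂` ∕ `hΨd`, and the fibre clause of the
canonical chart `Ψ_{𝐁_k(Z),W,U₀}` — ρ5a over §3. [cite: Balaban1985Variational, Sect. C p.285, (81)–(83) p.290; Balaban1988Convergent, (2.10)–(2.13) pp.256–257] -/
theorem chartLetters_msChart_Bj_of_isMinimizer_of_class (ν : Stage7Numerics) (Kt : ℕ) {k : ℕ} (Z : Set (Site (F.P Kt) 0))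
    (hkK : k + 1 ≤ (F.P Kt).m + (F.P Kt).K) (hM4 : 4 * (F.P Kt).L ≤ ν.M₁) (hdiv : side (F.P Kt).L ν.M₁ k ∣ (F.P Kt).sitesPerDir 0)
    (hε : 0 ≤ ν.εreg) {ρ'' : ℝ} (hsbU : ∀ V : GaugeField (F.P Kt) 0 (SU N), ‖coeField V - 1‖ ≤ ρ'' → SmallBelow (avOfRecord F N Kt) k V)
    (hερ : 6 * ((((F.P Kt).d - 1 : ℕ)) : ℝ) * (F.P Kt).L * ν.εreg ≤ ρ'')
    {W : MSField (F.P Kt) (SU N)} {U₀ : GaugeField (F.P Kt) 0 (SU N)}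
    (h : IsMinimizer (avOfRecord F N Kt) (regMSCoPOfRecord F N ν Kt k (maxDomT ν.M₁ Z)) (Bj ν.M₁ Z k) W U₀) :
    ContDiffAt ℝ ⊤ (msChart F N Kt k (Bj ν.M₁ Z k) W U₀) 0 ∧
    HasStrictFDerivAt (msChart F N Kt k (Bj ν.M₁ Z k) W U₀) (fderiv ℝ (msChart F N Kt k (Bj ν.M₁ Z k) W U₀) 0) 0 ∧
    (HasFDerivAt (fun Y => fderiv ℝ (msChart F N Kt k (Bj ν.M₁ Z k) W U₀) Y) (fderiv ℝ (fderiv ℝ (msChart F N Kt k (Bj ν.M₁ Z k) W U₀)) 0) 0 ∧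
      ∀ᶠ Y in 𝓝 (0 : PBond (F.P Kt) 0 → lieSU (Fin N)), DifferentiableAt ℝ (msChart F N Kt k (Bj ν.M₁ Z k) W U₀) Y) ∧
    (∀ᶠ X in 𝓝 (0 : PBond (F.P Kt) 0 → lieSU (Fin N)),
      msChart F N Kt k (Bj ν.M₁ Z k) W U₀ X = msChart F N Kt k (Bj ν.M₁ Z k) W U₀ 0 → AgreeOn (Bj ν.M₁ Z k) (avgFamily (avOfRecord F N Kt) (expChart U₀ X)) W) := by
  obtain ⟨h1, h2, h3, h4⟩ := chartLetters_msChart_of_towerProxies (by omega) h.2.1 (towerProxies_Bj_of_mem_class ν Kt Z hkK hM4 hdiv hε hsbU hερ h.1)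
  exact ⟨h1, h2, h3, h4 fun _ hj => Bj_of_gt hj⟩

end Summit.QuantumFields.YangMills.BalabanUVNodes.N12TowerProxiesOfClass

end
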